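import Summits.AnomalousDissipation.AnomalousDissipation.Theses.TaylorCertificates
import Summits.AnomalousDissipation.AnomalousDissipation.Theorems.TaylorCertificatePair.Negative.Modes
import Literature.Analysis.FunctionSpaces.TorusFluidGlueProofs
import Literature.Analysis.FunctionSpaces.TorusCalculusProofs
import Literature.Analysis.FunctionSpaces.TorusTestFunction

/-!
# Stub `stub_workIdentity` of the line `Sketch` (helical path) for the crux
# `TaylorCertificates.SmoothEulerCoerciveForce` (stmt-AnomalousDissipation-14097)

The classical "a steady force does no work on a steady state" identity on the flat torus `T³`:
if `v` is a smooth divergence-free mean-zero field satisfying the weak steady forced Euler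
identity `∫ ⟪(v·∇)v - f, w⟫ = 0` against every smooth divergence-free mean-zero test field `w`,
for a smooth force `f`, then `∫ ⟪f, v⟫ = 0`.

Proof: test with `w := v` itself (admissible), split the integral (both summands are smooth, hence
integrable on the compact torus), and use `∫ ⟪(v·∇)v, v⟫ = 0` for smooth divergence-free `v`
(`Torus.integral_inner_convect_self_eq_zero`; Evans, *Partial Differential Equations*, App. C.2,
Thm. 2 with empty boundary). [folklore]

Not here: the strong form with pressure, the Bernoulli-head transport, the Lamb form and the
vorticity equation (the other stubs of the line), nor the composition into the crux.
-/

-- `Summit.<Summit>.<Problem>` is the tree's mandated summit-side namespace (CONVENTIONS §2); for this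
-- single-conjunct summit the two coincide, so the duplicate is deliberate.
set_option linter.dupNamespace false

noncomputable section

open MeasureTheory
open scoped InnerProductSpace

namespace Summit.AnomalousDissipation.AnomalousDissipation.Theorems.SmoothEulerCoerciveForce.Helical

open Literature.Analysis.FunctionSpaces
open Summit.AnomalousDissipation.AnomalousDissipation.Theses.TaylorCertificates
open Summit.AnomalousDissipation.AnomalousDissipation.Theorems.TaylorCertificatePair.Negative

/-- **Work identity (general force).** A smooth divergence-free mean-zero weak steady Euler state
`v` of a smooth force `f` on `T³` (`∫ ⟪(v·∇)v - f, w⟫ = 0` for all smooth divergence-free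
mean-zero `w`) does no work against the force: `∫ ⟪f, v⟫ = 0`. Test with `w := v` and use
`∫ ⟪(v·∇)v, v⟫ = 0` (`Torus.integral_inner_convect_self_eq_zero`). [folklore] -/
theorem stub_workIdentity
    (f v : UnitAddTorus (Fin 3) → EuclideanSpace ℝ (Fin 3))
    (hf : Torus.IsSmooth f) (hvs : Torus.IsSmooth v) (hvd : Torus.IsDivFree v)
    (hvz : Torus.HasZeroMean v)
    (hq : ∀ w : UnitAddTorus (Fin 3) → EuclideanSpace ℝ (Fin 3), Torus.IsSmooth w → Torus.IsDivFree w →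
      Torus.HasZeroMean w → ∫ x, inner ℝ (Torus.convect v v x - f x) (w x) = 0) :
    ∫ x, inner ℝ (f x) (v x) = 0 := by
  have hsplit : ∫ x, ⟪Torus.convect v v x - f x, v x⟫_ℝ
      = (∫ x, ⟪Torus.convect v v x, v x⟫_ℝ) - ∫ x, ⟪f x, v x⟫_ℝ := by
    simp_rw [inner_sub_left]
    exact integral_sub ((hvs.convect hvs).inner hvs).integrable (hf.inner hvs).integrable
  have h := hq v hvs hvd hvz
  rw [hsplit, Torus.integral_inner_convect_self_eq_zero hvs hvd, zero_sub, neg_eq_zero] at h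
  exact h

end Summit.AnomalousDissipation.AnomalousDissipation.Theorems.SmoothEulerCoerciveForce.Helical

end
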